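import Summits.HodgeConjecture.HodgeCM.PerL34.LocTorusCompact_1

/-! PORT of `HodgeCM/PerL34/LocTorusCompact.lean` (HodgeCMPerL run 82) — part 2: continuation of `Summits.HodgeConjecture.HodgeCM.PerL34.LocTorusCompact_1` (split at a top-level declaration boundary by port_pkg.py; scope re-opened below; declarations unchanged). -/

-- port_pkg: scope re-opened for this part (file-level context, then the namespace/section stack open at the cut)
noncomputable section
open Topology Filter Set Sum IsDedekindDomain NumberField
open Literature.NumberTheory Literature.NumberTheory.Automorphic
open scoped RestrictedProduct Classical
namespace HodgeCM.PerL34.IdelicTorusModel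
open IdelePlaces RestrictedRegroup RestrictedCutout
variable (K L : Type) [Field K] [Field L] [Algebra K L] [NumberField K] [NumberField L]
section fixedInfinite
variable {K L}
variable (σ : L ≃ₐ[K] L) {w : InfinitePlace L} {v : InfinitePlace K}
variable [FiniteDimensional K L]
/-- **(d1), archimedean part: `U_v = locTorus K L v` is compact at an infinite place `v` of `K` under a `σ`-fixed
place `w`**; END binder `hcpt v`. -/
theorem compactSpace_locTorus_inl_of_fixed [IsGalois K L] (hwv : w.comap (algebraMap K L) = v)
    (h2 : ∀ τ : L ≃ₐ[K] L, τ = 1 ∨ τ = σ) (hσ : σ ≠ 1) (hfix : σ • w = w) : CompactSpace (locTorus K L (inl v)) :=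
  isCompact_iff_compactSpace.1 (isCompact_locTorus_inl_of_fixed σ hwv h2 hσ hfix)

end fixedInfinite

/-! ## §6  CM fields: complex conjugation fixes every infinite place -/

section CM

variable {K}
variable [IsCMField L]

omit [NumberField K] in
/-- **(d1) for `L` CM over `K = L⁺`: `U_v` is compact at every infinite place `v = w|_{L⁺}` of `L⁺`** (tree
`NumberField.complexConj_smul_infinitePlace`: `c • w = w`). -/
theorem compactSpace_locTorus_inl_of_isCMField (w : InfinitePlace L) :
    CompactSpace (locTorus (maximalRealSubfield L) L (inl (w.comap (algebraMap (maximalRealSubfield L) L)))) :=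
  compactSpace_locTorus_inl_of_fixed (IsCMField.complexConj L) rfl (eq_one_or_eq_complexConj L)
    (IsCMField.complexConj_ne_one L) (complexConj_smul_infinitePlace L w)

omit [NumberField K] in
/-- Every infinite place `v` of `L⁺` is `w|_{L⁺}` for some infinite place `w` of `L` (Mathlib
`InfinitePlace.comap_surjective`), so `U_v` is compact at EVERY infinite place of `L⁺`. -/
theorem compactSpace_locTorus_inl_of_isCMField' (v : InfinitePlace (maximalRealSubfield L)) :
    CompactSpace (locTorus (maximalRealSubfield L) L (inl v)) := by
  obtain ⟨w, rfl⟩ := InfinitePlace.comap_surjective (k := maximalRealSubfield L) (K := L) v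
  exact compactSpace_locTorus_inl_of_isCMField L w

omit [NumberField K] in
/-- **(d1) for `L` CM over `K = L⁺`, finite places: if `c • w = w` ("`v = w ∩ L⁺` is inert or ramified in `L`")
then `U_v` is compact** — `compactSpace_locTorus_of_fixed` at `σ := c`. -/
theorem compactSpace_locTorus_inr_of_isCMField {w : HeightOneSpectrum (𝓞 L)}
    {v : HeightOneSpectrum (𝓞 (maximalRealSubfield L))} (hwv : w.under (𝓞 (maximalRealSubfield L)) = v)
    (hfix : IsCMField.complexConj L • w = w) : CompactSpace (locTorus (maximalRealSubfield L) L (inr v)) :=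
  compactSpace_locTorus_of_fixed (IsCMField.complexConj L) hwv (eq_one_or_eq_complexConj L)
    (IsCMField.complexConj_ne_one L) hfix

omit [NumberField K] in
/-- … and then the level at `v` is all of `U_v` (END `hBi`) — `inH_eq_top_of_fixed` at `σ := c`. -/
theorem inH_eq_top_inr_of_isCMField {w : HeightOneSpectrum (𝓞 L)}
    {v : HeightOneSpectrum (𝓞 (maximalRealSubfield L))} (hwv : w.under (𝓞 (maximalRealSubfield L)) = v)
    (hfix : IsCMField.complexConj L • w = w) :
    inH (fun k => fibSubgroup (intUnits L) (pl (maximalRealSubfield L) L) k) (locTorus (maximalRealSubfield L) L)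
      (inr v) = ⊤ :=
  inH_eq_top_of_fixed (IsCMField.complexConj L) hwv (eq_one_or_eq_complexConj L) (IsCMField.complexConj_ne_one L) hfix

end CM

end HodgeCM.PerL34.IdelicTorusModel

-- port_pkg: scope closed for this part
end
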